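import Summits.Ventures.YMGap.Thresholds.PressureThirdDerivativeTwoSided
import HarnessLib

/-!
# NO CUBIC TERM AT `β = 0`: `g'''(0) = 0` for the Wilson-normalised free energy `g(β_W) = f(β_W/2)`, and the plaquette
# susceptibility has ZERO SLOPE at `β_W = 0⁺` (`u''(0⁺) = 0`, the second Balian–Drouffe–Itzykson coefficient) — C-PRESS3, part 3

Cell `pub-ymgap`, seat ds-1 (gen 10). HONEST FRAMING: strong-coupling LATTICE statement for `SU(2)` Wilson lattice gauge theory on
`ℤ⁴` about the infinite-volume free energy density in Wilson's normalisation `g(β_W) = f(β_W/2)`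
(`= lim L⁻⁴ log ∫ exp(-β_W Σ_p (1 - ½ Re tr U_p))`); exact third derivative at `β_W = 0` — NOT analyticity; nothing about the
continuum or the Clay problem. 0 compute.

* `su2_wilson_deriv_eq`, `su2_wilson_deriv_deriv_eq` — on `|β_W| < 9/25`: `g'(β_W) = ½ f'(β_W/2)`, `g''(β_W) = ¼ f''(β_W/2)`;
* ★ `su2_wilson_hasDerivAt_deriv_deriv_zero` — `g''` is differentiable at `0` with `g'''(0) = ⅛ f'''(0) = 0`
  (part 2's `su2_hasDerivAt_deriv_deriv_freeEnergyDensity_zero`); with g9's `g'(0) = -6`, `g''(0) = 3/2`: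
  `g(β_W) = -6β_W + (3/4)β_W² + 0·β_W³ + o(β_W³)` — the strong-coupling series of the free energy has no cubic term
  (Balian–Drouffe–Itzykson 1975: `u(β_W) = β_W/4 + O(β_W³)` is odd, `g' = -6(1 - u)`);
* ★ `su2_hasDerivWithinAt_susceptibility_zero` — STATE LEVEL: along any DLR selection on `[0, 9/25]`, the plaquette
  susceptibility `u'(β_W) = Σ_q Cov_{β_W}(W_p, W_q)` (`= 1/4` at `β_W = 0`, g9) has RIGHT DERIVATIVE `0` at `β_W = 0`
  (`u''(0⁺) = Σ_q Σ_r u₃(W_p; W_q; W_r)₀ = 0`): the second BDI coefficient of the mean plaquette vanishes, kernel-checked.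
-/

noncomputable section

open MeasureTheory ProbabilityTheory Set Filter Topology
open Literature.MathematicalPhysics.QuantumLattice (LGConfig ZdPlaquette fundamentalRep ymGibbsMeasures plaquetteEdges freeEnergyDensity)
open Literature.MathematicalPhysics.QuantumFieldTheory hiding ZdEdge

namespace Summit.Ventures.YMGap.PressureRegularity

section Wilson

/-- Local shorthand: the `SU(2)` free energy density in the tree coupling. -/
local notation3 (prettyPrint := false) "𝑓" => freeEnergyDensity 4 (fundamentalRep (Fin 2))

/-- `f` and `f'` are differentiable on the open two-sided window (from g9's `C²` statement). -/
theorem su2_differentiableOn_pair_abs :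
    DifferentiableOn ℝ 𝑓 (Ioo (-(9 / 50) : ℝ) (9 / 50)) ∧ DifferentiableOn ℝ (deriv 𝑓) (Ioo (-(9 / 50) : ℝ) (9 / 50)) := by
  have h2 := su2_contDiffOn_two_freeEnergyDensity_abs
  rw [show (2 : WithTop ℕ∞) = 1 + 1 from rfl, contDiffOn_succ_iff_deriv_of_isOpen isOpen_Ioo] at h2
  obtain ⟨hd1, -, h1⟩ := h2
  rw [show (1 : WithTop ℕ∞) = 0 + 1 from (zero_add 1).symm, contDiffOn_succ_iff_deriv_of_isOpen isOpen_Ioo] at h1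
  exact ⟨hd1, h1.1⟩

/-- **`g'(β_W) = ½ f'(β_W/2)`** as a derivative statement at every `|β_W| < 9/25`. -/
theorem su2_wilson_hasDerivAt {s : ℝ} (hs : s ∈ Ioo (-(9 / 25) : ℝ) (9 / 25)) :
    HasDerivAt (fun βW : ℝ => 𝑓 (βW / 2)) ((1 / 2 : ℝ) * deriv 𝑓 (s / 2)) s := by
  have hs' : s / 2 ∈ Ioo (-(9 / 50) : ℝ) (9 / 50) := ⟨by linarith [hs.1], by linarith [hs.2]⟩
  have hf : HasDerivAt 𝑓 (deriv 𝑓 (s / 2)) (s / 2) :=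
    ((su2_differentiableOn_pair_abs.1 _ hs').differentiableAt (Ioo_mem_nhds hs'.1 hs'.2)).hasDerivAt
  have hinner : HasDerivAt (fun βW : ℝ => βW / 2) (1 / 2 : ℝ) s := by
    simpa using (hasDerivAt_id s).div_const (2 : ℝ)
  have hc := HasDerivAt.comp s hf hinner
  refine hc.congr_deriv ?_
  ring

/-- **`g'(β_W) = ½ f'(β_W/2)`** on `|β_W| < 9/25`. -/
theorem su2_wilson_deriv_eq {s : ℝ} (hs : s ∈ Ioo (-(9 / 25) : ℝ) (9 / 25)) :
    deriv (fun βW : ℝ => 𝑓 (βW / 2)) s = (1 / 2 : ℝ) * deriv 𝑓 (s / 2) :=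
  (su2_wilson_hasDerivAt hs).deriv

/-- **`(g')'(β_W) = ¼ f''(β_W/2)`** as a derivative statement at every `|β_W| < 9/25`. -/
theorem su2_wilson_hasDerivAt_deriv {s : ℝ} (hs : s ∈ Ioo (-(9 / 25) : ℝ) (9 / 25)) :
    HasDerivAt (deriv fun βW : ℝ => 𝑓 (βW / 2)) ((1 / 4 : ℝ) * deriv (deriv 𝑓) (s / 2)) s := by
  have hs' : s / 2 ∈ Ioo (-(9 / 50) : ℝ) (9 / 50) := ⟨by linarith [hs.1], by linarith [hs.2]⟩
  have hf : HasDerivAt (deriv 𝑓) (deriv (deriv 𝑓) (s / 2)) (s / 2) :=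
    ((su2_differentiableOn_pair_abs.2 _ hs').differentiableAt (Ioo_mem_nhds hs'.1 hs'.2)).hasDerivAt
  have hinner : HasDerivAt (fun βW : ℝ => βW / 2) (1 / 2 : ℝ) s := by
    simpa using (hasDerivAt_id s).div_const (2 : ℝ)
  have hc := (HasDerivAt.comp s hf hinner).const_mul (1 / 2 : ℝ)
  refine (hc.congr_of_eventuallyEq ?_).congr_deriv (by ring)
  filter_upwards [Ioo_mem_nhds hs.1 hs.2] with t ht
  rw [su2_wilson_deriv_eq ht]
  rfl

/-- **`g''(β_W) = ¼ f''(β_W/2)`** on `|β_W| < 9/25`. -/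
theorem su2_wilson_deriv_deriv_eq {s : ℝ} (hs : s ∈ Ioo (-(9 / 25) : ℝ) (9 / 25)) :
    deriv (deriv fun βW : ℝ => 𝑓 (βW / 2)) s = (1 / 4 : ℝ) * deriv (deriv 𝑓) (s / 2) :=
  (su2_wilson_hasDerivAt_deriv hs).deriv

/-- ★ **`g'''(0) = 0`**: `g'' = deriv (deriv g)` is differentiable at `β_W = 0` with derivative `⅛ f'''(0) = 0` — the cubic
Taylor coefficient of the Wilson-normalised free energy density at infinite temperature vanishes:
`g(β_W) = -6β_W + (3/4)β_W² + 0·β_W³ + o(β_W³)`. -/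
theorem su2_wilson_hasDerivAt_deriv_deriv_zero :
    HasDerivAt (deriv (deriv fun βW : ℝ => 𝑓 (βW / 2))) (0 : ℝ) 0 := by
  have h0 := su2_hasDerivAt_deriv_deriv_freeEnergyDensity_zero
  have hinner : HasDerivAt (fun βW : ℝ => βW / 2) (1 / 2 : ℝ) 0 := by
    simpa using (hasDerivAt_id (0 : ℝ)).div_const (2 : ℝ)
  have h0' : HasDerivAt (deriv (deriv 𝑓)) (0 : ℝ) ((fun βW : ℝ => βW / 2) 0) := by
    rw [show (fun βW : ℝ => βW / 2) 0 = 0 by norm_num]; exact h0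
  have hc := (HasDerivAt.comp (0 : ℝ) h0' hinner).const_mul (1 / 4 : ℝ)
  refine (hc.congr_of_eventuallyEq ?_).congr_deriv (by ring)
  filter_upwards [Ioo_mem_nhds (show (-(9 / 25) : ℝ) < 0 by norm_num) (show (0 : ℝ) < 9 / 25 by norm_num)] with t ht
  rw [su2_wilson_deriv_deriv_eq ht]
  rfl

/-- **`deriv³ g (0) = 0`.** -/
theorem su2_wilson_deriv_deriv_deriv_zero :
    deriv (deriv (deriv fun βW : ℝ => 𝑓 (βW / 2))) 0 = 0 :=
  su2_wilson_hasDerivAt_deriv_deriv_zero.deriv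

end Wilson

section Susceptibility

open Summit.Ventures.YMGap.CouplingResponse (su2_hasDerivAt_responseSum_star su2_continuousOn_threePointSum
  su2_continuousOn_responseSum)

/-- Local shorthand: the normalised plaquette observable `W_q = ½ Re tr U_q` of `SU(2)` on `ℤ⁴`. -/
local notation3 (prettyPrint := false) "W∗" q:max =>
  zdPlaquetteObs (d := 4) (fundamentalRep (Fin 2)) (Prod.fst q) (Prod.snd q).1.1 (Prod.snd q).1.2

/-- ★ **The plaquette susceptibility has zero slope at `β_W = 0⁺`** (`u''(0⁺) = 0`): along any DLR selection `μ` on the Wilson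
window `[0, 9/25]` and for every plaquette `p`, `β_W ↦ Σ_q Cov_{μ β_W}(W_p, W_q)` has right derivative `0` at `β_W = 0` — it is
differentiable on `(0, 9/25)` with derivative the third response `Σ_q Σ_r u₃(W_p; W_q; W_r)` (`su2_hasDerivAt_responseSum_star`),
which is continuous on `[0, 9/25]` and VANISHES at `β_W = 0` (`su2_threePoint_zero`); limit-of-derivatives extension. -/
theorem su2_hasDerivWithinAt_susceptibility_zero
    {μ : ℝ → Measure (LGConfig 4 (Matrix.specialUnitaryGroup (Fin 2) ℂ))}
    (hμ : ∀ βW ∈ Icc (0 : ℝ) (9 / 25), μ βW ∈ ymGibbsMeasures (d := 4) (fundamentalRep (Fin 2)) (2 * (βW / 4)))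
    (p : ZdPlaquette 4) :
    HasDerivWithinAt (fun t => ∑' q : ZdPlaquette 4, cov[W∗ p, W∗ q; μ t]) (0 : ℝ) (Ici (0 : ℝ)) 0 := by
  classical
  have hW := isLipschitzCylinder_zdPlaquetteObs (N := 2) (d := 4) p.1 p.2.2
  have hD : ∀ e ∈ plaquetteEdges p, ‖e.1 - p.1‖ ≤ ((1 : ℕ) : ℝ) := fun e he => by
    simpa using norm_fst_sub_le_of_mem_plaquetteEdges he
  set S : ℝ → ℝ := fun t => ∑' q : ZdPlaquette 4, cov[W∗ p, W∗ q; μ t] with hS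
  set R : ℝ → ℝ := fun t => ∑' q : ZdPlaquette 4, ∑' r : ZdPlaquette 4, (cov[fun U => (W∗ p) U * (W∗ q) U, W∗ r; μ t] -
    (∫ U, (W∗ p) U ∂(μ t)) * cov[W∗ q, W∗ r; μ t] - (∫ U, (W∗ q) U ∂(μ t)) * cov[W∗ p, W∗ r; μ t]) with hR
  have hderiv : ∀ t ∈ Ioo (0 : ℝ) (9 / 25), HasDerivAt S (R t) t := fun t ht =>
    su2_hasDerivAt_responseSum_star le_rfl hμ hW hD ht
  have hRcont : ContinuousOn R (Icc (0 : ℝ) (9 / 25)) := su2_continuousOn_threePointSum le_rfl hμ hW hD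
  have hScont : ContinuousOn S (Icc (0 : ℝ) (9 / 25)) := su2_continuousOn_responseSum le_rfl hμ hW hD
  have h0 : μ 0 ∈ ymGibbsMeasures (d := 4) (fundamentalRep (Fin 2)) 0 := by
    simpa using hμ 0 ⟨le_rfl, by norm_num⟩
  have hR0 : R 0 = 0 := by
    have h := fun q r => su2_threePoint_zero h0 p q r
    show (∑' q : ZdPlaquette 4, ∑' r : ZdPlaquette 4, _) = 0
    exact (tsum_congr fun q => (tsum_congr fun r => h q r).trans tsum_zero).trans tsum_zero
  have hdiff : DifferentiableOn ℝ S (Ioo (0 : ℝ) (9 / 25)) := fun t ht =>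
    (hderiv t ht).differentiableAt.differentiableWithinAt
  have hcont : ContinuousWithinAt S (Ioo (0 : ℝ) (9 / 25)) 0 :=
    (hScont 0 ⟨le_rfl, by norm_num⟩).mono Ioo_subset_Icc_self
  have hlim : Tendsto (fun t => deriv S t) (𝓝[>] 0) (𝓝 0) := by
    have h := ((hRcont 0 ⟨le_rfl, by norm_num⟩).mono Ioo_subset_Icc_self).tendsto
    rw [hR0, nhdsWithin_Ioo_eq_nhdsGT (show (0 : ℝ) < 9 / 25 by norm_num)] at h
    refine h.congr' ?_
    filter_upwards [Ioo_mem_nhdsGT (show (0 : ℝ) < 9 / 25 by norm_num)] with t ht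
    exact (hderiv t ht).deriv.symm
  exact hasDerivWithinAt_Ici_of_tendsto_deriv hdiff hcont (Ioo_mem_nhdsGT (by norm_num)) hlim

end Susceptibility

end Summit.Ventures.YMGap.PressureRegularity

end
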